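import Summits.QuantumFields.YangMills.Theorems.TwistedTraceScaling.Negative.ShellIsValleyBelowLine
import HarnessLib

/-!
# Negative lemma R23 (crux `TwistedTraceScaling`, stmt-QuantumFields-20203): the exponent WINDOW of lane A's ONE-SITE SHELL GAIN `t^{3/2}` and of the
# §22.6 cell architecture — `1/6 < s < 2/9`; the sample cell radius is misstated on the whole core window; at equal exponents `1/5` the constants fight for `L ≤ 3`

Standing disprover `ym-cdisprove-20203-1` (gen 18, second file), vetting the newly typed C4-SHELL texts of lane A (ym-luscher-20007-p1 g11): COARSE-DESIGN §22.6
(06:40Z; record exponents revised to CORE `s = 1/5`, SHELL `InnerShellGainSmallAt L (β^{−1/5}) (β^{−1/40}) (β^{−17/20})`) and `…TwistedTraceScalingOneSiteShellGainPrelim`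
(part 1 of the one-site shell gain: `qform su2Rep B f f ≤ linkCE B·(1 − t√t/40)·l2 f f` for `f = 0` on `{‖zmCoord 1 U‖ < t}`, `t ∈ [B^{−1/5}, 1/5000]`, `B = L³β`).
All statements below are exponent bookkeeping at the scales `powScale p β = (max β 1)^{−p}`; `t = β^{−s}` is the innermost (binding) cell of the shell.  Kernel-checked:
* §1 generic comparison of two polynomial scales: `C·β^{−a} ≤ D·β^{−b}` holds eventually if `b < a` (`D > 0`) and fails eventually if `a < b` (`C > 0`)
  (`mul_powScale_le_eventually`, `not_mul_powScale_le_eventually`); `powScale_add'`, `gain_at_core_eq` (`(β^{−s})^{3/2} = β^{−3s/2}`), `sample_cell_radius_eq`,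
  `kinetic_length_eq`.
* §2 ★ `oneSite_gain_dominates_iff`: the one-site gain `t^{3/2}/40` at `t = β^{−s}` dominates every multiple of `λ_b(L³β)` — what `ValleyGainAt`/`InnerShellGainSmallAt`
  (`∀ A`, factor `e^{−Aλ_b}`) asks of it — iff `s < 2/9`; with the TRUE linear slope of the valley zero-point energy (Lüscher; B. Simon 1983) it would be iff `s < 1/3`
  (`linear_gain_dominates_iff`).  Record `s = 1/5`: shell margin exponent `1/3 − 3/10 = 1/30`, core margin `2/5 − 1/3 = 1/15`; balanced point `s = 4/21` (margin `1/21`);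
  the geometry line of R22 sits BELOW: `17/80 < 2/9 = (8/9)/4` (`window_record`).
* §3 the §22.6(a) CELLS at the innermost radius: the SAMPLE cell radius `r_cell = t^{3/4}β^{−1/8}` meets its first-order budget `C·r_cell ≤ γ(t)/4` (`γ(t) = t^{3/2}/20`)
  eventually iff `s < 1/6` (`sample_cell_first_order_of_lt_sixth` / ★ `sample_cell_first_order_fails_of_sixth_lt`, record instance `…_fails_record`) — jointly EMPTY with
  the core condition `s > 1/6` (R21/R22): a misstated sample, not a dead method, because the REPAIRED radius `r = θ·γ(t)` has IMS cost `θ⁻²β^{−(1−3s)} ≤ γ(t)/4` eventually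
  iff `s < 2/9` (★ `repaired_cell_ims_of_lt` / `repaired_cell_ims_fails_of_lt` — the SAME line as §2: both read `β·γ³ → ∞`) and the kinetic-length / one-site-error
  constraints `(βt)^{−1/2}, B^{−1/2}t^{−1/2} ≪ γ(t)` live on the quarter line `s < 1/4` (`quarter_line_of_lt` / `quarter_line_fails_of_lt`).  Net method window:
  `1/6 < s < 2/9` (width `1/18`), record `1/5` inside.
* §4 EQUAL EXPONENTS `1/5` (core radius `β^{−1/5}/2` vs one-site threshold `B^{−1/5}`, `B = L³β`): the comparison is the β-free `L^{−3/5} ≤ 1/2`, i.e. `32 ≤ L³` —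
  ★ `record_radius_lt_oneSite_threshold`: for `L³ < 32` (`L ∈ {1, 2, 3}`) and EVERY `β ≥ 1`, `β^{−1/5}/2 < (L³β)^{−1/5}`, while the two-zone door needs only `2 ≤ L`;
  any `s < 1/5` clears it eventually (`oneSite_threshold_le_radius_eventually`).
READING (for lane A, OWNER ym-beyond-p1, LEAD twolattice; no stub is false, nothing here is `¬InnerShellGainSmallAt`): (i) the `t^{3/2}` one-site gain confines the
core exponent to `s < 2/9` — fine at `1/5` (thin margin `β^{1/30}`); (ii) replace the sample `r_cell = t_j^{3/4}β^{−1/8}` by `r_cell = θ·t_j^{3/2}` (or any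
`β^{−1/2}t_j^{−3/4} ≪ r ≪ t_j^{3/2}`), else the inner decade `[β^{−1/5}, ≍β^{−1/6}]` of the record shell violates `C·r_cell ≤ γ/4`; (iii) take `s < 1/5` strictly
(e.g. `4/21`, `3/16`) or lower the one-site threshold to `B^{−a}`, `a ∈ (1/5, 1/4)` (its only job is `Bt⁴ → ∞` polynomially), else `L = 2, 3` are excluded by constants
(modulo the `orbitDist`/`‖zmCoord‖` comparison constant, which only moves the threshold `L`).
HONEST FRAMING: exponent bookkeeping about typed/design-level sub-targets (C4-SHELL of S-BASE) of a child of the CONDITIONAL reduction route (femto rung R2b1);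
the one-site theorem, `InnerShellGainSmallAt`, C3/C4, the stubs and the crux stay OPEN; not `¬TwistedTraceScaling`, not infinite volume, not a gap, not Clay.
Sorry-free, no new definition; axioms ⊆ {propext, Classical.choice, Quot.sound}.
-/

set_option autoImplicit false

noncomputable section

open Real
open Literature.MathematicalPhysics.QuantumFieldTheory
open Literature.MathematicalPhysics.QuantumLattice
open Summit.QuantumFields.YangMills.Theorems.FemtoTransferGap

namespace Summit.QuantumFields.YangMills.Theorems.TwistedTraceScaling.Negative.R23

variable {L : ℕ} [NeZero L]

/-! ## §1 Generic comparison of polynomial scales -/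

/-- `β^{−(a+b)} = β^{−a}·β^{−b}` at the scales `powScale`. [folklore] -/
theorem powScale_add' (a b β : ℝ) : powScale (a + b) β = powScale a β * powScale b β := by
  unfold powScale
  rw [neg_add, Real.rpow_add (lt_max_of_lt_right one_pos)]

/-- The one-site gain at the innermost cell: `(β^{−s})^{3/2} = β^{−3s/2}`. [folklore] -/
theorem gain_at_core_eq (s β : ℝ) : powScale s β ^ ((3 : ℝ) / 2) = powScale (3 * s / 2) β := by
  unfold powScale
  rw [← Real.rpow_mul (le_max_of_le_right zero_le_one)]
  congr 1
  ring

/-- The SAMPLE cell radius of §22.6(a) at the innermost cell `t = β^{−s}` (`β ≥ 1`): `t^{3/4}·β^{−1/8} = β^{−(3s/4 + 1/8)}`. [folklore] -/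
theorem sample_cell_radius_eq {β : ℝ} (hβ : 1 ≤ β) (s : ℝ) :
    powScale s β ^ ((3 : ℝ) / 4) * β ^ (-(1 / 8 : ℝ)) = powScale (3 * s / 4 + 1 / 8) β := by
  rw [powScale_add', powScale_eq (p := 1 / 8) hβ]
  congr 1
  unfold powScale
  rw [← Real.rpow_mul (le_max_of_le_right zero_le_one)]
  congr 1
  ring

/-- The one-site kinetic length at the innermost cell `t = β^{−s}` (`β ≥ 1`): `(βt)^{−1/2} = β^{−(1−s)/2}` (the one-site error term `B^{−1/2}t^{−1/2}`, `B = L³β`, has the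
same exponent). [folklore] -/
theorem kinetic_length_eq {β : ℝ} (hβ : 1 ≤ β) (s : ℝ) : (β * powScale s β) ^ (-(1 / 2 : ℝ)) = powScale ((1 - s) / 2) β := by
  have hβ0 : 0 < β := by linarith
  rw [powScale_eq hβ, powScale_eq hβ]
  rw [show β * β ^ (-s) = β ^ (1 - s) by rw [Real.rpow_sub hβ0, Real.rpow_one, div_eq_mul_inv, Real.rpow_neg hβ0.le]]
  rw [← Real.rpow_mul hβ0.le]
  congr 1
  ring

/-- ★ If `b < a` then `C·β^{−a} ≤ D·β^{−b}` eventually, for every `C` and every `D > 0`. [folklore] -/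
theorem mul_powScale_le_eventually {a b : ℝ} (hab : b < a) (C : ℝ) {D : ℝ} (hD : 0 < D) :
    ∃ β0 : ℝ, ∀ β : ℝ, β0 ≤ β → C * powScale a β ≤ D * powScale b β := by
  by_cases hC : C ≤ 0
  · refine ⟨0, fun β _ => ?_⟩
    have h1 : C * powScale a β ≤ 0 := by nlinarith [powScale_pos a β]
    have h2 : 0 ≤ D * powScale b β := (mul_pos hD (powScale_pos b β)).le
    linarith
  · push Not at hC
    obtain ⟨β0, h⟩ := rpow_neg_eventually_le (q := a - b) (M := D / C) (by linarith) (by positivity)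
    refine ⟨β0, fun β hβ => ?_⟩
    obtain ⟨hβ1, hle⟩ := h β hβ
    have hβ0' : 0 < β := by linarith
    rw [powScale_eq hβ1, powScale_eq hβ1]
    have hsplit : β ^ (-a) = β ^ (-(a - b)) * β ^ (-b) := by
      rw [← Real.rpow_add hβ0']; congr 1; ring
    rw [hsplit]
    have hb : 0 < β ^ (-b) := Real.rpow_pos_of_pos hβ0' _
    have hCD : C * (D / C) = D := by field_simp
    calc C * (β ^ (-(a - b)) * β ^ (-b)) = (C * β ^ (-(a - b))) * β ^ (-b) := by ring
      _ ≤ (C * (D / C)) * β ^ (-b) := mul_le_mul_of_nonneg_right (mul_le_mul_of_nonneg_left hle hC.le) hb.le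
      _ = D * β ^ (-b) := by rw [hCD]

/-- ★ If `a < b` then `C·β^{−a} ≤ D·β^{−b}` FAILS eventually (for every `C > 0`, every `D`): no `β0` works. [folklore] -/
theorem not_mul_powScale_le_eventually {a b : ℝ} (hab : a < b) {C : ℝ} (hC : 0 < C) (D : ℝ) :
    ¬ ∃ β0 : ℝ, ∀ β : ℝ, β0 ≤ β → C * powScale a β ≤ D * powScale b β := by
  rintro ⟨β0, h⟩
  by_cases hD : D ≤ 0
  · have h1 := h β0 le_rfl
    have h2 : 0 < C * powScale a β0 := mul_pos hC (powScale_pos a β0)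
    have h3 : D * powScale b β0 ≤ 0 := by nlinarith [powScale_pos b β0]
    linarith
  · push Not at hD
    obtain ⟨β1, h1⟩ := mul_powScale_le_eventually (a := b) (b := a) hab (2 * D) hC
    have hA := h (max β0 β1) (le_max_left _ _)
    have hB := h1 (max β0 β1) (le_max_right _ _)
    have hpos : 0 < D * powScale b (max β0 β1) := mul_pos hD (powScale_pos b _)
    linarith

/-! ## §2 The one-site gain `t^{3/2}/40` against `λ_b(L³β)`: the line `s = 2/9` -/

section Gain

variable (L)

/-- ★ **The one-site shell gain confines the core exponent to `s < 2/9`.**  At the innermost cell `t = β^{−s}` the gain of `…OneSiteShellGainPrelim` is `t^{3/2}/40 =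
β^{−3s/2}/40`; it dominates every multiple of `λ_b(L³β)` — the `∀ A, e^{−Aλ_b}` demand of `ValleyGainAt` / `InnerShellGainSmallAt` — iff `s < 2/9`. [cite: Luscher1983, §3] -/
theorem oneSite_gain_dominates_iff {s : ℝ} :
    (∀ M : ℝ, ∃ β0 : ℝ, ∀ β : ℝ, β0 ≤ β → M * bareLambda ((L : ℝ) ^ 3 * β) ≤ powScale (3 * s / 2) β / 40) ↔ s < 2 / 9 := by
  constructor
  · intro h
    by_contra hs
    push Not at hs
    have hp : (1 : ℝ) / 3 ≤ 3 * s / 2 := by linarith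
    apply R22.not_bareLambda_dominated_of_third_le L hp
    intro M
    obtain ⟨β0, hβ⟩ := h M
    refine ⟨β0, fun β hb => ?_⟩
    have h1 := hβ β hb
    have hpos := powScale_pos (3 * s / 2) β
    linarith
  · intro hs M
    have hp : 3 * s / 2 < 1 / 3 := by linarith
    obtain ⟨β0, h⟩ := powScale_dominates_bareLambda (L := L) hp (40 * M)
    refine ⟨β0, fun β hb => ?_⟩
    have h1 : 40 * M * bareLambda ((L : ℝ) ^ 3 * β) ≤ powScale (3 * s / 2) β := h β hb
    have h2 : 40 * (M * bareLambda ((L : ℝ) ^ 3 * β)) ≤ powScale (3 * s / 2) β := by rw [← mul_assoc]; exact h1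
    linarith

/-- With a gain LINEAR in the valley radius (slope `κ₁ > 0` — the true transverse zero-point slope `c_T` of Lüscher / B. Simon) the same demand holds iff `s < 1/3`:
the `t^{3/2}` of the supersolution costs the range `[2/9, 1/3)`. [cite: Luscher1983, §3] -/
theorem linear_gain_dominates_iff {s κ₁ : ℝ} (hκ : 0 < κ₁) :
    (∀ M : ℝ, ∃ β0 : ℝ, ∀ β : ℝ, β0 ≤ β → M * bareLambda ((L : ℝ) ^ 3 * β) ≤ κ₁ * powScale s β) ↔ s < 1 / 3 := by
  constructor
  · intro h
    by_contra hs
    push Not at hs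
    apply R22.not_bareLambda_dominated_of_third_le L hs
    intro M
    obtain ⟨β0, hβ⟩ := h (κ₁ * M)
    refine ⟨β0, fun β hb => ?_⟩
    have h1 : κ₁ * M * bareLambda ((L : ℝ) ^ 3 * β) ≤ κ₁ * powScale s β := hβ β hb
    have h2 : κ₁ * (M * bareLambda ((L : ℝ) ^ 3 * β)) ≤ κ₁ * powScale s β := by rw [← mul_assoc]; exact h1
    exact le_of_mul_le_mul_left h2 hκ
  · intro hs M
    obtain ⟨β0, h⟩ := powScale_dominates_bareLambda (L := L) hs (M / κ₁)
    refine ⟨β0, fun β hb => ?_⟩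
    have h1 : M / κ₁ * bareLambda ((L : ℝ) ^ 3 * β) ≤ powScale s β := h β hb
    have hk : κ₁ ≠ 0 := hκ.ne'
    have h2 : M * bareLambda ((L : ℝ) ^ 3 * β) = κ₁ * (M / κ₁ * bareLambda ((L : ℝ) ^ 3 * β)) := by field_simp
    rw [h2]
    exact mul_le_mul_of_nonneg_left h1 hκ.le

/-- The record numbers: shell line `3s/2 < 1/3 ⇔ s < 2/9`; at `s = 1/5` the shell margin exponent is `1/30`, the core margin `2s − 1/3` is `1/15`; the balanced point is
`s = 4/21` (both margins `1/21`); R22's geometry line `17/80` lies below `2/9 = (8/9)/4`; everything below the quarter line. [folklore] -/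
theorem window_record :
    (1 : ℝ) / 3 - 3 * (1 / 5) / 2 = 1 / 30 ∧ 2 * ((1 : ℝ) / 5) - 1 / 3 = 1 / 15 ∧ (1 : ℝ) / 3 - 3 * (4 / 21) / 2 = 1 / 21 ∧ 2 * ((4 : ℝ) / 21) - 1 / 3 = 1 / 21 ∧
      (1 : ℝ) / 6 < 4 / 21 ∧ (4 : ℝ) / 21 < 1 / 5 ∧ (1 : ℝ) / 5 < 17 / 80 ∧ (17 : ℝ) / 80 < 2 / 9 ∧ (8 : ℝ) / 9 / 4 = 2 / 9 ∧ (2 : ℝ) / 9 < 1 / 4 ∧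
      (2 : ℝ) / 9 - 1 / 6 = 1 / 18 := by
  norm_num

end Gain

/-! ## §3 The §22.6(a) cells at the innermost radius: sample radius, repaired radius, kinetic length -/

section Cells

/-- If `s < 1/6` the SAMPLE cell radius `r_cell = t^{3/4}β^{−1/8} = β^{−(3s/4+1/8)}` meets the first-order budget `C·r_cell ≤ γ(t)/4 = β^{−3s/2}/80` eventually … [folklore] -/
theorem sample_cell_first_order_of_lt_sixth {s : ℝ} (hs : s < 1 / 6) (C : ℝ) :
    ∃ β0 : ℝ, ∀ β : ℝ, β0 ≤ β → C * powScale (3 * s / 4 + 1 / 8) β ≤ powScale (3 * s / 2) β / 80 := by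
  obtain ⟨β0, h⟩ := mul_powScale_le_eventually (a := 3 * s / 4 + 1 / 8) (b := 3 * s / 2) (by linarith) C (D := 1 / 80) (by norm_num)
  exact ⟨β0, fun β hb => by have := h β hb; linarith⟩

/-- ★ … and if `1/6 < s` — the WHOLE core window of R21/R22, in particular the record — it FAILS eventually for every constant `C > 0`: the sample cell radius of
§22.6(a) is misstated on the inner cells `t_j ≲ β^{−1/6}` of the shell. [folklore] -/
theorem sample_cell_first_order_fails_of_sixth_lt {s : ℝ} (hs : 1 / 6 < s) {C : ℝ} (hC : 0 < C) :
    ¬ ∃ β0 : ℝ, ∀ β : ℝ, β0 ≤ β → C * powScale (3 * s / 4 + 1 / 8) β ≤ powScale (3 * s / 2) β / 80 := by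
  intro h
  apply not_mul_powScale_le_eventually (a := 3 * s / 4 + 1 / 8) (b := 3 * s / 2) (by linarith) hC (1 / 80)
  obtain ⟨β0, h⟩ := h
  exact ⟨β0, fun β hb => by have := h β hb; linarith⟩

/-- Record instance (`s = 1/5`): `C·β^{−11/40} ≤ β^{−3/10}/80` fails eventually. [folklore] -/
theorem sample_cell_first_order_fails_record {C : ℝ} (hC : 0 < C) :
    ¬ ∃ β0 : ℝ, ∀ β : ℝ, β0 ≤ β → C * powScale (3 * (1 / 5) / 4 + 1 / 8) β ≤ powScale (3 * (1 / 5) / 2) β / 80 :=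
  sample_cell_first_order_fails_of_sixth_lt (by norm_num) hC

/-- ★ The REPAIRED cell radius `r = θ·t^{3/2}` (`θ·C ≤ 1/80` settles the first-order budget outright): its IMS cost `1/(βr²) = θ⁻²β^{−(1−3s)}` (`β ≥ 1`) is
`≤ γ(t)/4 = β^{−3s/2}/80` eventually when `s < 2/9` — the same line as `oneSite_gain_dominates_iff` (both say `β·γ(t)³ → ∞`) … [folklore] -/
theorem repaired_cell_ims_of_lt {s : ℝ} (hs : s < 2 / 9) (θ : ℝ) :
    ∃ β0 : ℝ, ∀ β : ℝ, β0 ≤ β → (θ ^ 2)⁻¹ * powScale (1 - 3 * s) β ≤ powScale (3 * s / 2) β / 80 := by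
  obtain ⟨β0, h⟩ := mul_powScale_le_eventually (a := 1 - 3 * s) (b := 3 * s / 2) (by linarith) ((θ ^ 2)⁻¹) (D := 1 / 80) (by norm_num)
  exact ⟨β0, fun β hb => by have := h β hb; linarith⟩

/-- … and fails eventually when `2/9 < s` (`θ ≠ 0`). [folklore] -/
theorem repaired_cell_ims_fails_of_lt {s : ℝ} (hs : 2 / 9 < s) {θ : ℝ} (hθ : θ ≠ 0) :
    ¬ ∃ β0 : ℝ, ∀ β : ℝ, β0 ≤ β → (θ ^ 2)⁻¹ * powScale (1 - 3 * s) β ≤ powScale (3 * s / 2) β / 80 := by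
  intro h
  apply not_mul_powScale_le_eventually (a := 1 - 3 * s) (b := 3 * s / 2) (by linarith) (C := (θ ^ 2)⁻¹) (by positivity) (1 / 80)
  obtain ⟨β0, h⟩ := h
  exact ⟨β0, fun β hb => by have := h β hb; linarith⟩

/-- The identity behind `repaired_cell_ims_*`: `1/(β·(θ·t^{3/2})²) = θ⁻²·β^{−(1−3s)}` at `t = β^{−s}`, `β ≥ 1`, `θ ≠ 0`. [folklore] -/
theorem repaired_cell_ims_cost_eq {β : ℝ} (hβ : 1 ≤ β) {θ : ℝ} (hθ : θ ≠ 0) (s : ℝ) :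
    1 / (β * (θ * powScale s β ^ ((3 : ℝ) / 2)) ^ 2) = (θ ^ 2)⁻¹ * powScale (1 - 3 * s) β := by
  have hβ0 : 0 < β := by linarith
  have e1 : (powScale s β ^ ((3 : ℝ) / 2)) ^ 2 = β ^ (-(3 * s)) := by
    rw [gain_at_core_eq, powScale_eq hβ, ← Real.rpow_natCast, ← Real.rpow_mul hβ0.le]
    congr 1
    push_cast
    ring
  have e2 : powScale (1 - 3 * s) β = (β * β ^ (-(3 * s)))⁻¹ := by
    rw [powScale_eq hβ, Real.rpow_neg hβ0.le, Real.rpow_sub hβ0, Real.rpow_one, Real.rpow_neg hβ0.le, div_eq_mul_inv]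
  have hb : 0 < β ^ (-(3 * s)) := Real.rpow_pos_of_pos hβ0 _
  rw [mul_pow, e1, e2]
  field_simp

/-- The QUARTER LINE: `C·β^{−(1−s)/2} ≤ D·β^{−3s/2}` — kinetic length `(βt)^{−1/2} ≪ r = θγ(t)` and one-site error `104·B^{−1/2}t^{−1/2} ≤ 0.021·t^{3/2}` (`B = L³β`) at the
innermost cell — holds eventually when `s < 1/4` (`D > 0`) … [folklore] -/
theorem quarter_line_of_lt {s : ℝ} (hs : s < 1 / 4) (C : ℝ) {D : ℝ} (hD : 0 < D) :
    ∃ β0 : ℝ, ∀ β : ℝ, β0 ≤ β → C * powScale ((1 - s) / 2) β ≤ D * powScale (3 * s / 2) β :=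
  mul_powScale_le_eventually (by linarith) C hD

/-- … and fails eventually when `1/4 < s` (`C > 0`): §22.6(c)'s «(b) needs `t ≫ B^{−1/4}`», certified. [folklore] -/
theorem quarter_line_fails_of_lt {s : ℝ} (hs : 1 / 4 < s) {C : ℝ} (hC : 0 < C) (D : ℝ) :
    ¬ ∃ β0 : ℝ, ∀ β : ℝ, β0 ≤ β → C * powScale ((1 - s) / 2) β ≤ D * powScale (3 * s / 2) β :=
  not_mul_powScale_le_eventually (by linarith) hC D

end Cells

/-! ## §4 Equal exponents `1/5`: core radius `β^{−1/5}/2` versus the one-site threshold `B^{−1/5}`, `B = L³β` -/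

section Threshold

variable (L)

/-- ★ For `L³ < 32` (`L ∈ {1, 2, 3}`) and EVERY `β ≥ 1`: `β^{−1/5}/2 < (L³β)^{−1/5}` — at equal exponents the record core radius stays BELOW the one-site theorem's
validity threshold; the comparison is the β-free `2 > L^{3/5}`.  (The two-zone door needs only `2 ≤ L`.) [folklore] -/
theorem record_radius_lt_oneSite_threshold {β : ℝ} (hβ : 1 ≤ β) (hL3 : (L : ℝ) ^ 3 < 32) :
    powScale (1 / 5) β / 2 < ((L : ℝ) ^ 3 * β) ^ (-(1 / 5 : ℝ)) := by
  have hβ0 : 0 < β := by linarith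
  have hL1 : (0 : ℝ) < L := by exact_mod_cast Nat.pos_of_ne_zero (NeZero.ne L)
  have hL0 : (0 : ℝ) < (L : ℝ) ^ 3 := by positivity
  rw [powScale_eq hβ, Real.mul_rpow hL0.le hβ0.le]
  have hb : 0 < β ^ (-(1 / 5 : ℝ)) := Real.rpow_pos_of_pos hβ0 _
  suffices h : (1 : ℝ) / 2 < ((L : ℝ) ^ 3) ^ (-(1 / 5 : ℝ)) by
    have := mul_lt_mul_of_pos_right h hb
    linarith
  have hpos : 0 < ((L : ℝ) ^ 3) ^ (1 / 5 : ℝ) := Real.rpow_pos_of_pos hL0 _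
  have hroot : ((L : ℝ) ^ 3) ^ (1 / 5 : ℝ) < 2 := by
    by_contra hge
    push Not at hge
    have h5 : (2 : ℝ) ^ (5 : ℕ) ≤ (((L : ℝ) ^ 3) ^ (1 / 5 : ℝ)) ^ (5 : ℕ) := pow_le_pow_left₀ (by norm_num) hge 5
    have h6 : (((L : ℝ) ^ 3) ^ (1 / 5 : ℝ)) ^ (5 : ℕ) = (L : ℝ) ^ 3 := by
      rw [← Real.rpow_natCast, ← Real.rpow_mul hL0.le]
      norm_num
    rw [h6] at h5
    norm_num at h5
    linarith
  rw [Real.rpow_neg hL0.le, inv_eq_one_div]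
  exact one_div_lt_one_div_of_lt hpos hroot

/-- Instances `L = 2` and `L = 3` (`8, 27 < 32`; `L = 4` gives `64 ≥ 32`). [folklore] -/
theorem record_radius_lt_oneSite_threshold_two_three {β : ℝ} (hβ : 1 ≤ β) :
    powScale (1 / 5) β / 2 < (((2 : ℕ) : ℝ) ^ 3 * β) ^ (-(1 / 5 : ℝ)) ∧ powScale (1 / 5) β / 2 < (((3 : ℕ) : ℝ) ^ 3 * β) ^ (-(1 / 5 : ℝ)) ∧
      (32 : ℝ) ≤ ((4 : ℕ) : ℝ) ^ 3 :=
  ⟨record_radius_lt_oneSite_threshold 2 hβ (by norm_num), record_radius_lt_oneSite_threshold 3 hβ (by norm_num), by norm_num⟩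

/-- Any STRICTLY smaller core exponent clears the threshold eventually: `s < 1/5 ⇒ (L³β)^{−1/5} ≤ β^{−s}/2` for `β ≥ β0`. [folklore] -/
theorem oneSite_threshold_le_radius_eventually {s : ℝ} (hs : s < 1 / 5) :
    ∃ β0 : ℝ, ∀ β : ℝ, β0 ≤ β → ((L : ℝ) ^ 3 * β) ^ (-(1 / 5 : ℝ)) ≤ powScale s β / 2 := by
  have hL1 : (0 : ℝ) < L := by exact_mod_cast Nat.pos_of_ne_zero (NeZero.ne L)
  have hL0 : (0 : ℝ) < (L : ℝ) ^ 3 := by positivity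
  obtain ⟨β0, h⟩ := mul_powScale_le_eventually (a := 1 / 5) (b := s) hs (((L : ℝ) ^ 3) ^ (-(1 / 5 : ℝ))) (D := 1 / 2) (by norm_num)
  refine ⟨max β0 1, fun β hb => ?_⟩
  have hβ1 : 1 ≤ β := le_trans (le_max_right _ _) hb
  have hβ0' : 0 < β := by linarith
  have h1 := h β (le_trans (le_max_left _ _) hb)
  rw [powScale_eq (p := 1 / 5) hβ1] at h1
  rw [Real.mul_rpow hL0.le hβ0'.le]
  linarith

end Threshold

end Summit.QuantumFields.YangMills.Theorems.TwistedTraceScaling.Negative.R23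

end
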